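import Summits.Ventures.PercRepro.Night2ThreeTwoCountAssembly
import Summits.Ventures.PercRepro.Night2ThreeTwoPlane

/-!
# PercRepro — **THE `(3, 2)` OBSTRUCTION CELLS WITH `9 ≤ |V| ≤ 10` SATISFY (LI_G)** (night-2, gen 27)

The last `(3, 2)` residue of the `(7, 5)` shadow row.  The fat member `B₀` of the cell gives the plane
`P₀ = cl B₀ ∖ K` with `n − 2` points, `V ∖ P₀ = {a, b}`; every covering basis of a target has three points on `P₀`
(a «type A» basis, through one of `a, b`) or two (a «type B» basis, through both).  The top levels of the targets
of a lossy basis pair (`|T ∖ K| ≥ n − 2`, `cap3 ≥ 1 − 3/20 − C(n − 2, 2)/198`, `Night2ThreeTwoTopCaps`) pay for it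
with a refined count of the lossy covering bases:

* CASE I — some line of `V` carries `≥ n − 3` points: at most `lineCount` covering bases per target
  (`card_coverBases_le_lineCount`), the count sums `≥ 1.32` (`Night2ThreeTwoCountAssembly`, section `SmallSums`);
* CASE II — no such line: the type-B bases lose nothing (`faceLoss_sum_eq_zero_of_typeB`), so only the
  `j · C(i, 3)` type-A `4`-subsets count; the pair itself is of type A (profile `(3, 1)` along `P₀`), the count sums
  are `1.43` (`n = 9`) and `1.14` (`n = 10`).

* `basis_pair_fair_caseI`, `basis_pair_fair_caseII`: the fair-share inequality (ii) at a lossy basis pair;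
* **`localShadowHall_three_two_five_nine_ten`**: (LI_G) at every flat of the cell `(3, 2)` with a fat member and
  `9 ≤ |V| ≤ 10` (no saturated-target hypothesis is needed);
* **`shadowHall_seven_five_of_residuesZ''`**: `ShadowHall M 7 5 (phiK 7 5)` for every finite matroid modulo the
  `(2, 0)`, `(2, 1)` residues of the residues V alone — the `(3, 2)` column is closed.
-/

namespace PercRepro.Shadow

open Finset PerFlat ThmH

variable {α : Type*} [DecidableEq α] {M : Matroid α} [M.Finite]

section NineTen

variable {G : Finset α}

open scoped Classical in
/-- The flat `G` itself is a shadow set of every thin pair. -/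
theorem G_mem_shadowAt (hG : G ∈ flatsQ M (5 + 1)) {B : Finset α} (hB : B ∈ membersIn M (Uq M (5 + 2) 5) G)
    {z : α} (hz : z ∈ G \ clF M B) : G ∈ shadowAt M (5 + 2) 5 (Uq M (5 + 2) 5) G := by
  have hBU : B ∈ Uq M (5 + 2) 5 := (mem_membersIn.1 hB).1
  have hBG : B ⊆ G := (subset_clF hBU).trans (mem_membersIn.1 hB).2
  exact superset_mem_shadowAt hG hB hz (Finset.insert_subset (Finset.mem_sdiff.1 hz).1 hBG) (Finset.Subset.refl G)

open scoped Classical in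
/-- **CASE I — a line with `≥ n − 3` points**: the fair-share inequality at a lossy basis pair of a flat of the cell
with `9 ≤ |V| ≤ 10` from the line count. -/
theorem basis_pair_fair_caseI (hG : G ∈ flatsQ M (5 + 1)) (hd : (gr M \ G).card = 3) (hk : kColoops M G = 2)
    (hs : ∀ e ∈ gr M, ∀ f ∈ gr M, e ≠ f → rkN M {e, f} = 2) (hl : ∀ e ∈ gr M, M.Indep {e})
    (h9 : 9 ≤ (G \ coloops M G).card) (h10 : (G \ coloops M G).card ≤ 10)
    {L : Finset α} (hLr : rkN M L ≤ 2) (hLV : L ⊆ G \ coloops M G) (hL : (G \ coloops M G).card ≤ L.card + 3)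
    {B : Finset α} (hB : B ∈ thinMembers M 5 G) (hnP : ¬ BigMember M G B) {z : α} (hz : z ∈ G \ clF M B)
    (hl0 : loss M 5 G B z ≠ 0) :
    loss M 5 G B z ≤ rhoL M 5 G B z * lossIncomeH M 5 G (BigMember M G) (dshMissed M 5 G) B z := by
  have hd' : (gr M \ G).card ≤ 5 := by omega
  have hk' : kColoops M G + 4 = 5 + 1 := by omega
  have hKG : coloops M G ⊆ G := fun y hy => (mem_coloops.1 hy).1
  have hB' : B ∈ membersIn M (Uq M (5 + 2) 5) G := (mem_thinMembers.1 hB).1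
  have hGn : G.card - kColoops M G = (G \ coloops M G).card := by
    rw [Finset.card_sdiff_of_subset hKG, kColoops_eq_card_coloops]
  have hP' : ∀ B ∈ thinMembers M 5 G, ¬ BigMember M G B → (B \ coloops M G).card + 1 = 4 := by
    intro B hB hnP
    have h3 := card_sdiff_coloops_thin_ge hG hd' hk' hB
    unfold BigMember at hnP
    omega
  apply basis_pair_fair_of_qSumC hG hd hk hs hl (by omega) (by omega) hLV (cnt := lineCount) hB hnP hz hl0
  · -- the mass bound through the line count
    intro T hT
    have hTG : T ⊆ G := subset_G_of_mem_shadowAt (mem_tgtSets.1 hT).1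
    have hTE : ∀ T' ∈ coverBases M G T 4, ∑ w ∈ T', faceLoss M 5 G (coloops M G ∪ T') w ≤
        (((G \ coloops M G).card : ℚ) + 56) / (20 * ((G \ coloops M G).card : ℚ)) :=
      fun T' hT' => faceLoss_sum_le_three_two hG hd hk hs hl (by omega) T' hT'
    have h1 := pi2MassH_le_coverBases hG hd (by norm_num) hk' hP' T hTE
    rw [hGn] at h1
    have h2 := card_coverBases_le_lineCount (M := M) (G := G) T L hLr
    have h2' : ((coverBases M G T 4).card : ℚ) ≤
        ((lineCount ((T \ coloops M G) ∩ L).card ((T \ coloops M G) \ L).card : ℕ) : ℚ) := by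
      exact_mod_cast h2
    have hED : 0 ≤ (((G \ coloops M G).card : ℚ) + 56) / (20 * ((G \ coloops M G).card : ℚ)) /
        ((2 ^ ((G \ coloops M G).card - 4) - 1 : ℕ) : ℚ) := by positivity
    simp only [profileAt]
    exact h1.trans (mul_le_mul_of_nonneg_right h2' hED)
  · -- the count sum: `n ∈ {9, 10}`, `|L| ∈ {n − 3, n − 2}`, `1 ≤ |T ∩ L| ≤ 2`
    set Q := insert z B with hQ
    have hQsh : Q ∈ shadowAt M (5 + 2) 5 (Uq M (5 + 2) 5) G := insert_mem_shadowAt_thin hG hB hz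
    have hQc : (Q \ coloops M G).card = 4 := by
      have hKB : coloops M G ⊆ B := coloops_subset_of_mem_thinMembers hG hd' hB
      have hzB : z ∉ B := notMem_of_notMem_clF (mem_membersIn.1 hB').1 (Finset.mem_sdiff.1 hz).2
      have hzK : z ∉ coloops M G := fun h => hzB (hKB h)
      rw [hQ, Finset.insert_sdiff_of_notMem _ hzK, Finset.card_insert_of_notMem
        (fun h => hzB (Finset.mem_sdiff.1 h).1), ← add_left_inj 1, hP' B hB hnP]
    have hQI : M.Indep (Q : Set α) := indep_of_mem_shadowAt_card hk' hQsh hQc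
    have hQV : Q \ coloops M G ⊆ G \ coloops M G :=
      Finset.sdiff_subset_sdiff (subset_G_of_mem_shadowAt hQsh) (Finset.Subset.refl _)
    -- `|V ∖ L| ≥ 2`: `rk V = 4 ≤ rk L + |V ∖ L|`
    have hV4 : rkN M (G \ coloops M G) = 4 := rkN_sdiff_coloops_eq_four hG hk (G_mem_shadowAt hG hB' hz)
    have hVL : 2 ≤ ((G \ coloops M G) \ L).card := by
      have h1 := rkN_union_le_add_card (M := M) L ((G \ coloops M G) \ L)
      rw [Finset.union_sdiff_of_subset hLV] at h1
      omega
    have hLcard : L.card + ((G \ coloops M G) \ L).card = (G \ coloops M G).card := by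
      rw [Finset.card_sdiff_of_subset hLV]
      have := Finset.card_le_card hLV
      omega
    -- the profile of `Q`
    have hi₀ : ((Q \ coloops M G) ∩ L).card ≤ 2 := by
      have hI : M.Indep (((Q \ coloops M G) ∩ L : Finset α) : Set α) :=
        hQI.subset (by exact_mod_cast (Finset.inter_subset_left.trans Finset.sdiff_subset))
      have h1 := rkN_eq_card_of_indep hI
      have h2 : rkN M ((Q \ coloops M G) ∩ L) ≤ rkN M L := rkN_mono Finset.inter_subset_right
      omega
    have hj₀ : ((Q \ coloops M G) \ L).card ≤ ((G \ coloops M G) \ L).card :=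
      Finset.card_le_card (Finset.sdiff_subset_sdiff hQV (Finset.Subset.refl _))
    have hij : ((Q \ coloops M G) ∩ L).card + ((Q \ coloops M G) \ L).card = 4 := by
      rw [add_comm, Finset.card_sdiff_add_card_inter, hQc]
    simp only [profileAt]
    -- the eight-way case split
    have hn : (G \ coloops M G).card = 9 ∨ (G \ coloops M G).card = 10 := by omega
    have hlam : L.card + 3 = (G \ coloops M G).card ∨ L.card + 2 = (G \ coloops M G).card := by omega
    have ht : ((Q \ coloops M G) ∩ L).card = 1 ∨ ((Q \ coloops M G) ∩ L).card = 2 := by omega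
    have hy : ((G \ coloops M G) \ L).card = (G \ coloops M G).card - L.card := by omega
    have hj : ((Q \ coloops M G) \ L).card = 4 - ((Q \ coloops M G) ∩ L).card := by omega
    rw [hy, hj]
    rcases hn with hn | hn <;> rcases hlam with hlam | hlam <;> rcases ht with ht | ht <;>
      simp only [hn, ht] at hlam hj₀ hy ⊢ <;> first
      | omega
      | (rw [show L.card = 6 by omega]; exact qSumC_line_9_6_1)
      | (rw [show L.card = 6 by omega]; exact qSumC_line_9_6_2)
      | (rw [show L.card = 7 by omega]; exact qSumC_line_9_7_2)
      | (rw [show L.card = 7 by omega]; exact qSumC_line_10_7_1)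
      | (rw [show L.card = 7 by omega]; exact qSumC_line_10_7_2)
      | (rw [show L.card = 8 by omega]; exact qSumC_line_10_8_2)

open scoped Classical in
/-- **CASE II — no line with `n − 3` points**: the fair-share inequality at a lossy basis pair of a flat of the cell
with `9 ≤ |V| ≤ 10` and a fat member `B₀`, from the count of the type-A covering bases along the plane
`P₀ = cl B₀ ∖ K`. -/
theorem basis_pair_fair_caseII (hG : G ∈ flatsQ M (5 + 1)) (hd : (gr M \ G).card = 3) (hk : kColoops M G = 2)
    (hs : ∀ e ∈ gr M, ∀ f ∈ gr M, e ≠ f → rkN M {e, f} = 2) (hl : ∀ e ∈ gr M, M.Indep {e})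
    (h9 : 9 ≤ (G \ coloops M G).card) (h10 : (G \ coloops M G).card ≤ 10)
    {B₀ : Finset α} (hB₀ : B₀ ∈ thinMembers M 5 G) (hm : (G \ clF M B₀).card ≤ 2)
    (hnoline : ∀ p ∈ G \ coloops M G, ∀ p' ∈ G \ coloops M G, p ≠ p' →
      (clF M {p, p'} ∩ (G \ coloops M G)).card + 4 ≤ (G \ coloops M G).card)
    {B : Finset α} (hB : B ∈ thinMembers M 5 G) (hnP : ¬ BigMember M G B) {z : α} (hz : z ∈ G \ clF M B)
    (hl0 : loss M 5 G B z ≠ 0) :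
    loss M 5 G B z ≤ rhoL M 5 G B z * lossIncomeH M 5 G (BigMember M G) (dshMissed M 5 G) B z := by
  have hd' : (gr M \ G).card ≤ 5 := by omega
  have hk' : kColoops M G + 4 = 5 + 1 := by omega
  have hKG : coloops M G ⊆ G := fun y hy => (mem_coloops.1 hy).1
  have hB' : B ∈ membersIn M (Uq M (5 + 2) 5) G := (mem_thinMembers.1 hB).1
  have hGn : G.card - kColoops M G = (G \ coloops M G).card := by
    rw [Finset.card_sdiff_of_subset hKG, kColoops_eq_card_coloops]
  have hP' : ∀ B ∈ thinMembers M 5 G, ¬ BigMember M G B → (B \ coloops M G).card + 1 = 4 := by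
    intro B hB hnP
    have h3 := card_sdiff_coloops_thin_ge hG hd' hk' hB
    unfold BigMember at hnP
    omega
  -- the plane `P₀ = cl B₀ ∖ K`, with `n − 2` points
  have hB₀' : B₀ ∈ membersIn M (Uq M (5 + 2) 5) G := (mem_thinMembers.1 hB₀).1
  have hB₀U : B₀ ∈ Uq M (5 + 2) 5 := (mem_membersIn.1 hB₀').1
  have hH₀G : clF M B₀ ⊆ G := (mem_membersIn.1 hB₀').2
  have hKH₀ : coloops M G ⊆ clF M B₀ := (coloops_subset_of_mem_thinMembers hG hd' hB₀).trans (subset_clF hB₀U)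
  have hm2 : (G \ clF M B₀).card = 2 := card_sdiff_clF_eq_two_of_le hG hd hB₀ hm
  set P₀ := clF M B₀ \ coloops M G with hP₀
  have hP₀V : P₀ ⊆ G \ coloops M G := Finset.sdiff_subset_sdiff hH₀G (Finset.Subset.refl _)
  have hVP₀ : (G \ coloops M G) \ P₀ = G \ clF M B₀ := sdiff_coloops_sdiff_eq hKH₀
  have hP₀r : rkN M P₀ ≤ 3 := rkN_clF_sdiff_coloops_le_three hG hd hk hB₀
  have hP₀card : P₀.card + 2 = (G \ coloops M G).card := by
    have h := Finset.card_sdiff_of_subset hP₀V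
    rw [hVP₀, hm2] at h
    have := Finset.card_le_card hP₀V
    omega
  -- a basis of `V` has three points on the plane, or two and then both missed points
  have hbasis : ∀ X : Finset α, X ⊆ G \ coloops M G → X.card = 4 →
      M.Indep ((coloops M G ∪ X : Finset α) : Set α) →
      (X ∩ P₀).card = 3 ∨ ((X ∩ P₀).card = 2 ∧ G \ clF M B₀ ⊆ X) := by
    intro X hXV hX4 hXI
    have hXI' : M.Indep (X : Set α) := hXI.subset (by exact_mod_cast (Finset.subset_union_right : X ⊆ coloops M G ∪ X))
    have h3 : (X ∩ P₀).card ≤ 3 := by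
      have hI : M.Indep ((X ∩ P₀ : Finset α) : Set α) :=
        hXI'.subset (by exact_mod_cast (Finset.inter_subset_left : X ∩ P₀ ⊆ X))
      have h1 := rkN_eq_card_of_indep hI
      have h2 : rkN M (X ∩ P₀) ≤ rkN M P₀ := rkN_mono Finset.inter_subset_right
      omega
    have hXsub : X \ P₀ ⊆ G \ clF M B₀ := by
      rw [← hVP₀]; exact Finset.sdiff_subset_sdiff hXV (Finset.Subset.refl _)
    have h2 := Finset.card_le_card hXsub
    have hXsplit := Finset.card_sdiff_add_card_inter X P₀
    rw [hm2] at h2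
    by_cases h : (X ∩ P₀).card = 3
    · exact Or.inl h
    · right
      have hc2 : (X ∩ P₀).card = 2 := by omega
      refine ⟨hc2, ?_⟩
      have heq : X \ P₀ = G \ clF M B₀ := Finset.eq_of_subset_of_card_le hXsub (by omega)
      rw [← heq]; exact Finset.sdiff_subset
  apply basis_pair_fair_of_qSumC hG hd hk hs hl (by omega) (by omega) hP₀V (cnt := planeCount) hB hnP hz hl0
  · -- the mass bound: only the type-A covering bases lose
    intro T hT
    have hTsh := (mem_tgtSets.1 hT).1
    have hTG : T ⊆ G := subset_G_of_mem_shadowAt hTsh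
    have h1 := pi2MassH_le_sum_coverBases hG hd (by norm_num) hk' hP' T
    rw [hGn] at h1
    set D : ℚ := ((2 ^ ((G \ coloops M G).card - 4) - 1 : ℕ) : ℚ) with hD
    set E : ℚ := (((G \ coloops M G).card : ℚ) + 56) / (20 * ((G \ coloops M G).card : ℚ)) with hE
    have hD0 : 0 ≤ D := by positivity
    have hE0 : 0 ≤ E := by positivity
    have hsplit : ∑ X ∈ coverBases M G T 4, (∑ w ∈ X, faceLoss M 5 G (coloops M G ∪ X) w) / D ≤
        ∑ _X ∈ (coverBases M G T 4).filter (fun X => (X ∩ P₀).card = 3), E / D := by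
      rw [← Finset.sum_filter_add_sum_filter_not (coverBases M G T 4) (fun X => (X ∩ P₀).card = 3)]
      have hzero : ∑ X ∈ (coverBases M G T 4).filter (fun X => ¬ (X ∩ P₀).card = 3),
          (∑ w ∈ X, faceLoss M 5 G (coloops M G ∪ X) w) / D = 0 := by
        apply Finset.sum_eq_zero
        intro X hX
        rw [Finset.mem_filter] at hX
        obtain ⟨hX, hne⟩ := hX
        have hX' := hX
        unfold coverBases at hX'
        rw [Finset.mem_filter, Finset.mem_powersetCard] at hX'
        obtain ⟨⟨hXS, hX4⟩, hXI⟩ := hX'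
        have hXV : X ⊆ G \ coloops M G := hXS.trans (Finset.sdiff_subset_sdiff hTG (Finset.Subset.refl _))
        rcases hbasis X hXV hX4 hXI with h3 | ⟨-, hab⟩
        · exact absurd h3 hne
        · rw [faceLoss_sum_eq_zero_of_typeB hG hd hk hs hB₀ hm hnoline hXV hX4 hXI hab, zero_div]
      rw [hzero, add_zero]
      apply Finset.sum_le_sum
      intro X hX
      have hX' := (Finset.mem_filter.1 hX).1
      exact div_le_div_of_nonneg_right (faceLoss_sum_le_three_two hG hd hk hs hl (by omega) X hX') hD0
    rw [Finset.sum_const, nsmul_eq_mul] at hsplit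
    have hcount := card_coverBases_filter_le (M := M) (G := G) T P₀ 3
    have hcount' : (((coverBases M G T 4).filter (fun X => (X ∩ P₀).card = 3)).card : ℚ) ≤
        ((planeCount ((T \ coloops M G) ∩ P₀).card ((T \ coloops M G) \ P₀).card : ℕ) : ℚ) := by
      unfold planeCount
      have h43 : ((T \ coloops M G) \ P₀).card.choose (4 - 3) = ((T \ coloops M G) \ P₀).card := by
        rw [show 4 - 3 = 1 from rfl, Nat.choose_one_right]
      rw [h43] at hcount
      rw [mul_comm]
      exact_mod_cast hcount
    simp only [profileAt]
    calc pi2MassH M 5 G (BigMember M G) T ≤ _ := h1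
      _ ≤ _ := hsplit
      _ ≤ _ := mul_le_mul_of_nonneg_right hcount' (div_nonneg hE0 hD0)
  · -- the count sum: the pair is of type A, profile `(3, 1)`
    set Q := insert z B with hQ
    have hQsh : Q ∈ shadowAt M (5 + 2) 5 (Uq M (5 + 2) 5) G := insert_mem_shadowAt_thin hG hB hz
    have hKB : coloops M G ⊆ B := coloops_subset_of_mem_thinMembers hG hd' hB
    have hzB : z ∉ B := notMem_of_notMem_clF (mem_membersIn.1 hB').1 (Finset.mem_sdiff.1 hz).2
    have hzK : z ∉ coloops M G := fun h => hzB (hKB h)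
    have hQc : (Q \ coloops M G).card = 4 := by
      rw [hQ, Finset.insert_sdiff_of_notMem _ hzK, Finset.card_insert_of_notMem
        (fun h => hzB (Finset.mem_sdiff.1 h).1), ← add_left_inj 1, hP' B hB hnP]
    have hQI : M.Indep (Q : Set α) := indep_of_mem_shadowAt_card hk' hQsh hQc
    have hQV : Q \ coloops M G ⊆ G \ coloops M G :=
      Finset.sdiff_subset_sdiff (subset_G_of_mem_shadowAt hQsh) (Finset.Subset.refl _)
    have hKQ : coloops M G ⊆ Q := coloops_subset_of_mem_shadowAt hQsh
    have hTI : M.Indep ((coloops M G ∪ (Q \ coloops M G) : Finset α) : Set α) := by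
      rw [Finset.union_sdiff_of_subset hKQ]; exact hQI
    rcases hbasis (Q \ coloops M G) hQV hQc hTI with h3 | ⟨-, hab⟩
    · have hj : ((Q \ coloops M G) \ P₀).card = 1 := by
        have := Finset.card_sdiff_add_card_inter (Q \ coloops M G) P₀
        omega
      have hy : ((G \ coloops M G) \ P₀).card = 2 := by rw [hVP₀, hm2]
      simp only [profileAt]
      rw [h3, hj, hy]
      have hn : (G \ coloops M G).card = 9 ∨ (G \ coloops M G).card = 10 := by omega
      rcases hn with hn | hn
      · rw [show P₀.card = 7 by omega, hn]; exact qSumC_plane_9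
      · rw [show P₀.card = 8 by omega, hn]; exact qSumC_plane_10
    · -- a type-B pair loses nothing: contradiction
      exfalso
      have hsum0 := faceLoss_sum_eq_zero_of_typeB hG hd hk hs hB₀ hm hnoline hQV hQc hTI hab
      rw [Finset.union_sdiff_of_subset hKQ] at hsum0
      have hzT : z ∈ Q \ coloops M G := Finset.mem_sdiff.2 ⟨Finset.mem_insert_self _ _, hzK⟩
      have hQe : Q.erase z = B := by rw [hQ]; exact Finset.erase_insert hzB
      have hfl : faceLoss M 5 G Q z = loss M 5 G B z := by
        unfold faceLoss
        rw [hQe, if_pos ⟨hB, hz⟩]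
      have hnn : ∀ w ∈ Q \ coloops M G, 0 ≤ faceLoss M 5 G Q w := fun w _ => faceLoss_nonneg hG hd' Q w
      have hle := Finset.single_le_sum hnn hzT
      rw [hsum0, hfl] at hle
      exact hl0 (le_antisymm hle (loss_nonneg' hG hd' B z))

open scoped Classical in
/-- **THE `(3, 2)` OBSTRUCTION CELLS WITH `9 ≤ |V| ≤ 10` SATISFY (LI_G)**: a flat of the cell `(3, 2)` with a fat member
(`|B₀ ∖ K| ≥ 4`, `|G ∖ cl B₀| ≤ 2`) and `9 ≤ |V| ≤ 10`.  No saturated-target hypothesis is needed. -/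
theorem localShadowHall_three_two_five_nine_ten (hG : G ∈ flatsQ M (5 + 1)) (hd : (gr M \ G).card = 3)
    (hk : kColoops M G = 2) (hs : ∀ e ∈ gr M, ∀ f ∈ gr M, e ≠ f → rkN M {e, f} = 2)
    (hl : ∀ e ∈ gr M, M.Indep {e})
    (hfm : ∃ B₀ ∈ thinMembers M 5 G, 4 ≤ (B₀ \ coloops M G).card ∧ (G \ clF M B₀).card ≤ 2)
    (h9 : 9 ≤ (G \ coloops M G).card) (h10 : (G \ coloops M G).card ≤ 10) : LocalShadowHall M 5 G := by
  have hd' : (gr M \ G).card ≤ 5 := by omega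
  obtain ⟨B₀, hB₀, -, hm⟩ := hfm
  apply localShadowHall_three_two_five_of_basisFair hG hd hk hs hl
  intro B hB hnB z hz
  by_cases hl0 : loss M 5 G B z = 0
  · rw [hl0]
    exact mul_nonneg (rhoL_nonneg hG hd' B z)
      (lossIncomeH_nonneg hG hd' (fun S _ => dload_missed_le_cap2_three_two hG hd hk hs hl (fun _ h => h) S) B z)
  by_cases hline : ∃ p ∈ G \ coloops M G, ∃ p' ∈ G \ coloops M G, p ≠ p' ∧
      (G \ coloops M G).card ≤ (clF M {p, p'} ∩ (G \ coloops M G)).card + 3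
  · obtain ⟨p, -, p', -, hne, hL⟩ := hline
    have hLr : rkN M (clF M {p, p'} ∩ (G \ coloops M G)) ≤ 2 := by
      have h1 : rkN M (clF M {p, p'} ∩ (G \ coloops M G)) ≤ rkN M (clF M {p, p'}) :=
        rkN_mono Finset.inter_subset_left
      have h2 : rkN M (clF M {p, p'}) = rkN M {p, p'} := rkN_clF _
      have h3 : rkN M {p, p'} ≤ ({p, p'} : Finset α).card := rkN_le_card _
      have h4 : ({p, p'} : Finset α).card = 2 := Finset.card_pair hne
      omega
    exact basis_pair_fair_caseI hG hd hk hs hl h9 h10 hLr Finset.inter_subset_right hL hB hnB hz hl0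
  · push Not at hline
    have hnoline : ∀ p ∈ G \ coloops M G, ∀ p' ∈ G \ coloops M G, p ≠ p' →
        (clF M {p, p'} ∩ (G \ coloops M G)).card + 4 ≤ (G \ coloops M G).card := by
      intro p hp p' hp' hne
      have := hline p hp p' hp' hne
      omega
    exact basis_pair_fair_caseII hG hd hk hs hl h9 h10 hB₀ hm hnoline hB hnB hz hl0

end NineTen

section SevenFiveZ''

variable {α' : Type} [DecidableEq α']

open scoped Classical in
/-- **THE `(7, 5)` SHADOW ROW FOR EVERY FINITE MATROID MODULO THE RESIDUES `(2, 0)`, `(2, 1)` ALONE**: the `(3, 2)`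
column of the residues is closed — the obstruction cells with `|V| ≥ 11` (gens 25–26), `|V| = 8` (gen 26) and
`9 ≤ |V| ≤ 10` (this module) all satisfy (LI_G). -/
theorem shadowHall_seven_five_of_residuesZ''
    (h20 : ∀ (N : Matroid α') [N.Finite] (G : Finset α'), CellHyp N G →
      (gr N \ G).card = 2 → kColoops N G = 0 → FatMember N G 6 3 →
      (FatBasis N G 6 2 ∨ FatMember N G 6 2) →
      (2 ≤ (fatClosures N 5 G 2).card ∨
        ∃ B ∈ thinMembers N 5 G, 2 < (G \ clF N B).card ∧ (G \ clF N B).card < 5) →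
      LocalShadowHall N 5 G)
    (h21 : ∀ (N : Matroid α') [N.Finite] (G : Finset α'), CellHyp N G →
      (gr N \ G).card = 2 → kColoops N G = 1 → FatMember N G 5 4 →
      (FatBasis N G 5 3 ∨ FatMember N G 5 3) →
      (2 ≤ (fatClosures N 5 G 2).card ∨
        ∃ B ∈ thinMembers N 5 G, 2 < (G \ clF N B).card ∧ (G \ clF N B).card < 7) →
      LocalShadowHall N 5 G)
    (M : Matroid α') [M.Finite] : ShadowHall M 7 5 (phiK 7 5) := by
  apply shadowHall_seven_five_of_residuesZ' h20 h21
  intro N _ G hcell hd hk hfm _ h9 h10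
  exact localShadowHall_three_two_five_nine_ten hcell.2.2.2 hd hk hcell.1 hcell.2.1 hfm h9 h10

end SevenFiveZ''

end PercRepro.Shadow
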